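import Summits.CriticalPhenomena.CardyFormulaZ2.Theses.CardyBondTriangular
import Summits.CriticalPhenomena.CardyFormulaZ2.Theorems.CardyIKTransportCornerLineDescentCrudeContinuity
import Summits.CriticalPhenomena.CardyFormulaZ2.Theorems.CardyBondTriangularTriangularToSquareTransportStubBoundaryInsensitivitySq
import Summits.CriticalPhenomena.CardyFormulaZ2.Theorems.CardyBondTriangularTriangularToSquareTransportStubLowerCrossingTriSubsetCrude
import Literature.Probability.Percolation.QuadCrossingContinuityEventsDischarge
import Literature.Probability.Percolation.RSW

/-!
# Skeleton of the crux `TriangularToSquareTransport` — line `registered` (birth), RESHAPED by the lead (cycles 1–2)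
(item `stmt-CriticalPhenomena-4665`, route `route-CriticalPhenomena-CardyBondTriangular`, sub-problem
`CardyFormulaZ2`; lead `prover-line-stmt-CriticalPhenomena-4665-0`, 2026-08-17)

The crux `X_tr`: for every `Φ : ℝ → ℝ`, if canonical bond percolation on the triangular lattice `𝕋`
(`bondPercolation triGraph (criticalWeightI (π/6))`, drawn isoradially by
`z_𝕋 x = √3 (triEmbed x − (1+ζ)/3)`, mesh-`δ` edges of length `√3 δ`) has crude crossing limits
`Φ(η_R)` for every conformal rectangle `R` (crude event `embDomainCrossing`: an open path with all
vertices in `Ω = R.carrier`, from the `2δ`-neighbourhood of `A = R.arc 0` to the `2δ`-neighbourhood of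
`B = R.arc 2`), then so has bond percolation on `ℤ²` at `p = 1/2` drawn by `squareLatticeEmbedding.z`
(`x ↦ √2 · x`, edges of length `√2 δ`).

## The line (same composition idea as the birth skeleton: shadow transport with an `o(1)` slack, then
remove the slack), reshaped after wave 1

Wave 1 (2026-08-17): `stub_boundaryInsensitivitySq` LANDED for every conformal rectangle
(`Theorems/CardyBondTriangularTriangularToSquareTransportStubBoundaryInsensitivitySq.lean`, p148884) from
the tree's PROVED mesh-uniform continuity of crude bond-`ℤ²` crossings
`Freeze.CrudeCrossingContinuity R` (`stub_CrudeCrossingContinuity_of_SS` ∘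
`QuadCrossing.SchrammSmirnov2011_lemma_5_1_holds`, all quads); `stub_boundaryInsensitivityTri` came
back `stub-blocked: GrimmettManolescuAOP2013_triangular_boxCrossing` (RSW for bond-`𝕋`, item 7023,
open) and would moreover need a `𝕋`-port of the ≈ 7k-line SS11 chain. RESHAPE (the `𝕋`-side boundary
bookkeeping is eliminated, not weakened): all slack is removed on `ℤ²`, where the continuity is a
theorem, by stating the shadow transport for the right events —

* `stub_lowerTransport` — HEART, direction `ℤ² → 𝕋` (research-level; the `(𝕋, ℤ²)` instance of the
  bi-periodic universality coupling announced as [HM24], cf. DKKMO2020 Thm 1.2, Manolescu2025 Thm 5.3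
  inside `𝕃(α)`): for every `R` there is a mesh correspondence `m → 0⁺` such that for all collar
  scales `κ > 0`, thinning radii `ρ > 0` and `ε > 0`, eventually in `δ`,
  `P_ℤ(lower_ℤ(R; κ, ρ; δ)) ≤ P_𝕋(lower_𝕋(R; κ, ρ/2; m δ)) + ε`. Here `lower` is the THINNED
  COLLAR-TO-COLLAR event of `CornerLineDescent.SymmetricSeed.Freeze` (`Freeze.lowerCrossing`: an open
  path whose vertices have their closed `ρ`-balls inside the enlarged domain
  `Freeze.enlarge R κ = Ω ∪ collar₀ ∪ collar₂`, from a vertex whose ball lies in `collar₀ ∖ Ω` to one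
  whose ball lies in `collar₂ ∖ Ω`), written for `𝕋` with the `𝕋`-drawing. It is what a coupling
  moving every macroscopic open path by `< ρ/2 − δ` delivers (a point of the shadow is within `ρ/2` of
  the `ℤ²`-polygon, whose points carry `(ρ − δ/√2)`-balls inside the enlarged domain).
* `stub_upperTransport` — HEART, direction `𝕋 → ℤ²`: for every `R` there is `m → 0⁺` with, for all
  `ρ > 0`, `ε > 0`, eventually `P_𝕋(crude_𝕋(R; m δ)) ≤ P_ℤ(relaxed_ℤ(R; ρ; δ)) + ε`, where `relaxed`
  is the birth skeleton's `ρ`-relaxed crude event (vertices in `Metric.thickening ρ Ω`, endpoints within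
  `2δ + ρ` of the arcs) — what a shadow within `ρ − 2 m δ` delivers.
* `stub_lowerCrossingTri_subset_crude` — deterministic run extraction on `𝕋` (provable now, S): for
  configurations on the edges of `triGraph` and meshes with `√3 δ ≤ κ`, `lower_𝕋(R; κ, ρ; δ) ⊆
  crude_𝕋(R; δ)` (mirror of `Freeze.lowerCrossing_subset_embDomainCrossing`; the generic
  `Freeze.exists_crossing_run` plus the `𝕋` edge length `√3 δ ≤ 2δ`).
* `stub_boundaryInsensitivitySq` — CLOSED (landed, wave 1): `P_ℤ(relaxed_ℤ(R; ρ; δ)) ≤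
  P_ℤ(crude_ℤ(R; δ)) + ε` for `ρ ≤ ρ₀(R, ε)`, eventually in `δ`.

`TriangularToSquareTransport_of_directed` (sorry-free; hypotheses = the directed `Sig.stub_lowerTransport`,
`Sig.stub_upperTransport` and the two closed stubs; conclusion literally the route decl;
`TriangularToSquareTransport_of` takes the merged heart instead): fix `Φ`, the `𝕋`-hypothesis `hT`, `R`, a uniformizing datum with cross-ratio `η`,
`L = Φ η`, `ε > 0`. UPPER: `P_ℤ(crude) ≤ P_ℤ(upper_ρ)` (`Freeze.embDomainCrossing_subset_upperCrossing`,
`2δ ≤ ρ`) `≤ P_ℤ(lower_{κ,ρ}) + ε/4` (tree continuity at `ε/4`) `≤ P_𝕋(lower_𝕋(κ, ρ/2; m δ)) + ε/2`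
(`stub_lowerTransport`) `≤ P_𝕋(crude_𝕋(m δ)) + ε/2` (`stub_lowerCrossingTri_subset_crude`, a.s. on
lattice edges) `< L + 3ε/4` (`hT ∘ m`). LOWER: `L − ε/4 < P_𝕋(crude_𝕋(m' δ))` (`hT ∘ m'`)
`≤ P_ℤ(relaxed_{ρ₀}) + ε/4` (`stub_upperTransport`) `≤ P_ℤ(crude) + ε/2` (`stub_boundaryInsensitivitySq`).
The hypothesis is used at `R` only; no `Φ`-continuity, no comparison rectangles, no RSW for bond-`𝕋`.
`TriangularToSquareTransport_of_stubs` feeds the four `stub_*` BY NAME.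

Wave 2 (2026-08-17): `stub_lowerCrossingTri_subset_crude` LANDED (p151080,
`Theorems/CardyBondTriangularTriangularToSquareTransportStubLowerCrossingTriSubsetCrude.lean`);
`stub_upperTransport` came back `stub-blocked: DKKMO2020_thm21_quadCrossingProb` (closest tree
declaration: same shape, but 𝕃(α) vs 𝕃(π/2) only, and itself an unproved named fact). The two directed
hearts are therefore MERGED into the single registered stub `stub_shadowTransport :=
Sig.stub_lowerTransport ∧ Sig.stub_upperTransport` (cycle 2 registration): it is the `(𝕋, ℤ²)`
universality coupling itself, read on the two event families the composition needs, and it is the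
only open stub of the line; everything else is proved.

Superseded stubs of the birth registration: `stub_transportCoupling` (replaced by the two directed
transports on thinned/relaxed events), `stub_boundaryInsensitivityTri` (eliminated; blocked on RSW-`𝕋`
+ XL port — see `Lines/birth-lead-c1.md`).

Disproof used: none on file for this crux (`ledger crux ls`, 2026-08-17: no `Disproof.lean`, no
`Negative/`).
-/

namespace Summit.CriticalPhenomena.CardyFormulaZ2.Cruxes.TriangularToSquareTransport.Birth

open Filter Topology MeasureTheory

/-! ### Stub signatures (`Sig.<stub>` is literally the statement of `<stub>`; all constants are tree /
Mathlib declarations, fully qualified so that stub files can copy them verbatim) -/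

/-- Signature of `stub_lowerTransport` (heart, `ℤ² → 𝕋` on thinned collar-to-collar events). -/
def Sig.stub_lowerTransport : Prop :=
    ∀ R : Literature.Probability.RandomPlanarGeometry.ConformalRectangle, ∃ m : ℝ → ℝ,
      Tendsto m (𝓝[>] (0 : ℝ)) (𝓝[>] (0 : ℝ)) ∧
      ∀ κ : ℝ, 0 < κ → ∀ ρ : ℝ, 0 < ρ → ∀ ε : ℝ, 0 < ε → ∀ᶠ δ : ℝ in 𝓝[>] (0 : ℝ),
        (Literature.Probability.Percolation.bondPercolation (Literature.Probability.LatticeModels.zdGraph 2) Literature.Probability.Percolation.half).real (Summit.CriticalPhenomena.CardyFormulaZ2.Theorems.CornerLineDescent.SymmetricSeed.Freeze.lowerCrossing R κ ρ δ)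
          ≤ (Literature.Probability.Percolation.bondPercolation Literature.Probability.LatticeModels.triGraph (Literature.Probability.LatticeModels.criticalWeightI (Real.pi / 6))).real (Literature.Probability.Percolation.openCrossing {x : Literature.Probability.LatticeModels.Site 2 | Metric.closedBall (((m δ : ℝ) : ℂ) * ((Real.sqrt 3 : ℂ) * (Literature.Probability.LatticeModels.triEmbed x - (1 + Literature.Probability.LatticeModels.triZeta) / 3))) (ρ / 2) ⊆ Summit.CriticalPhenomena.CardyFormulaZ2.Theorems.CornerLineDescent.SymmetricSeed.Freeze.enlarge R κ} {x : Literature.Probability.LatticeModels.Site 2 | Metric.closedBall (((m δ : ℝ) : ℂ) * ((Real.sqrt 3 : ℂ) * (Literature.Probability.LatticeModels.triEmbed x - (1 + Literature.Probability.LatticeModels.triZeta) / 3))) (ρ / 2) ⊆ Summit.CriticalPhenomena.CardyFormulaZ2.Theorems.CornerLineDescent.SymmetricSeed.Freeze.sideCollar R 0 κ \ R.carrier} {x : Literature.Probability.LatticeModels.Site 2 | Metric.closedBall (((m δ : ℝ) : ℂ) * ((Real.sqrt 3 : ℂ) * (Literature.Probability.LatticeModels.triEmbed x - (1 + Literature.Probability.LatticeModels.triZeta)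 / 3))) (ρ / 2) ⊆ Summit.CriticalPhenomena.CardyFormulaZ2.Theorems.CornerLineDescent.SymmetricSeed.Freeze.sideCollar R 2 κ \ R.carrier}) + ε

/-- Signature of `stub_upperTransport` (heart, `𝕋 → ℤ²`, crude to relaxed). -/
def Sig.stub_upperTransport : Prop :=
    ∀ R : Literature.Probability.RandomPlanarGeometry.ConformalRectangle, ∃ m : ℝ → ℝ,
      Tendsto m (𝓝[>] (0 : ℝ)) (𝓝[>] (0 : ℝ)) ∧
      ∀ ρ : ℝ, 0 < ρ → ∀ ε : ℝ, 0 < ε → ∀ᶠ δ : ℝ in 𝓝[>] (0 : ℝ),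
        (Literature.Probability.Percolation.bondPercolation Literature.Probability.LatticeModels.triGraph (Literature.Probability.LatticeModels.criticalWeightI (Real.pi / 6))).real (Literature.Probability.Percolation.embDomainCrossing (fun x : Literature.Probability.LatticeModels.Site 2 ↦ (Real.sqrt 3 : ℂ) * (Literature.Probability.LatticeModels.triEmbed x - (1 + Literature.Probability.LatticeModels.triZeta) / 3)) R.carrier (m δ) (R.arc 0) (R.arc 2))
          ≤ (Literature.Probability.Percolation.bondPercolation (Literature.Probability.LatticeModels.zdGraph 2) Literature.Probability.Percolation.half).real (Literature.Probability.Percolation.openCrossing {y : Literature.Probability.LatticeModels.Site 2 | (δ : ℂ) * Literature.Probability.LatticeModels.squareLatticeEmbedding.z y ∈ Metric.thickening ρ R.carrier} {u : Literature.Probability.LatticeModels.Site 2 | Metric.infDist ((δ : ℂ) * Literature.Probability.LatticeModels.squareLatticeEmbedding.z u) (R.arc 0) ≤ 2 * δ + ρ} {v : Literature.Probability.LatticeModels.Site 2 | Metric.infDist ((δ : ℂ) * Literature.Probability.LatticeModels.squareLatticeEmbedding.z v) (R.arc 2) ≤ 2 * δ + ρ}) + ε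

/-- Signature of `stub_shadowTransport` — THE REGISTERED HEART: the conjunction of the two directed
transports (`Sig.stub_lowerTransport ∧ Sig.stub_upperTransport`, bodies inlined verbatim). -/
def Sig.stub_shadowTransport : Prop :=
    (∀ R : Literature.Probability.RandomPlanarGeometry.ConformalRectangle, ∃ m : ℝ → ℝ,
      Tendsto m (𝓝[>] (0 : ℝ)) (𝓝[>] (0 : ℝ)) ∧
      ∀ κ : ℝ, 0 < κ → ∀ ρ : ℝ, 0 < ρ → ∀ ε : ℝ, 0 < ε → ∀ᶠ δ : ℝ in 𝓝[>] (0 : ℝ),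
        (Literature.Probability.Percolation.bondPercolation (Literature.Probability.LatticeModels.zdGraph 2) Literature.Probability.Percolation.half).real (Summit.CriticalPhenomena.CardyFormulaZ2.Theorems.CornerLineDescent.SymmetricSeed.Freeze.lowerCrossing R κ ρ δ)
          ≤ (Literature.Probability.Percolation.bondPercolation Literature.Probability.LatticeModels.triGraph (Literature.Probability.LatticeModels.criticalWeightI (Real.pi / 6))).real (Literature.Probability.Percolation.openCrossing {x : Literature.Probability.LatticeModels.Site 2 | Metric.closedBall (((m δ : ℝ) : ℂ) * ((Real.sqrt 3 : ℂ) * (Literature.Probability.LatticeModels.triEmbed x - (1 + Literature.Probability.LatticeModels.triZeta) / 3))) (ρ / 2) ⊆ Summit.CriticalPhenomena.CardyFormulaZ2.Theorems.CornerLineDescent.SymmetricSeed.Freeze.enlarge R κ} {x : Literature.Probability.LatticeModels.Site 2 | Metric.closedBall (((m δ : ℝ) : ℂ) * ((Real.sqrt 3 : ℂ) * (Literature.Probability.LatticeModels.triEmbed x - (1 + Literature.Probability.LatticeModels.triZeta) / 3))) (ρ / 2) ⊆ Summit.CriticalPhenomena.CardyFormulaZ2.Theorems.CornerLineDescent.SymmetricSeed.Freeze.sideCollar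 R 0 κ \ R.carrier} {x : Literature.Probability.LatticeModels.Site 2 | Metric.closedBall (((m δ : ℝ) : ℂ) * ((Real.sqrt 3 : ℂ) * (Literature.Probability.LatticeModels.triEmbed x - (1 + Literature.Probability.LatticeModels.triZeta) / 3))) (ρ / 2) ⊆ Summit.CriticalPhenomena.CardyFormulaZ2.Theorems.CornerLineDescent.SymmetricSeed.Freeze.sideCollar R 2 κ \ R.carrier}) + ε) ∧
    (∀ R : Literature.Probability.RandomPlanarGeometry.ConformalRectangle, ∃ m : ℝ → ℝ,
      Tendsto m (𝓝[>] (0 : ℝ)) (𝓝[>] (0 : ℝ)) ∧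
      ∀ ρ : ℝ, 0 < ρ → ∀ ε : ℝ, 0 < ε → ∀ᶠ δ : ℝ in 𝓝[>] (0 : ℝ),
        (Literature.Probability.Percolation.bondPercolation Literature.Probability.LatticeModels.triGraph (Literature.Probability.LatticeModels.criticalWeightI (Real.pi / 6))).real (Literature.Probability.Percolation.embDomainCrossing (fun x : Literature.Probability.LatticeModels.Site 2 ↦ (Real.sqrt 3 : ℂ) * (Literature.Probability.LatticeModels.triEmbed x - (1 + Literature.Probability.LatticeModels.triZeta) / 3)) R.carrier (m δ) (R.arc 0) (R.arc 2))
          ≤ (Literature.Probability.Percolation.bondPercolation (Literature.Probability.LatticeModels.zdGraph 2) Literature.Probability.Percolation.half).real (Literature.Probability.Percolation.openCrossing {y : Literature.Probability.LatticeModels.Site 2 | (δ : ℂ) * Literature.Probability.LatticeModels.squareLatticeEmbedding.z y ∈ Metric.thickening ρ R.carrier} {u : Literature.Probability.LatticeModels.Site 2 | Metric.infDist ((δ : ℂ) * Literature.Probability.LatticeModels.squareLatticeEmbedding.z u) (R.arc 0) ≤ 2 * δ + ρ} {v : Literature.Probability.LatticeModels.Site 2 | Metric.infDist ((δ : ℂ)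 * Literature.Probability.LatticeModels.squareLatticeEmbedding.z v) (R.arc 2) ≤ 2 * δ + ρ}) + ε)

/-- Signature of `stub_lowerCrossingTri_subset_crude` (deterministic run extraction on `𝕋`). -/
def Sig.stub_lowerCrossingTri_subset_crude : Prop :=
    ∀ R : Literature.Probability.RandomPlanarGeometry.ConformalRectangle, ∀ κ ρ δ : ℝ, 0 < δ → 0 ≤ ρ →
      Real.sqrt 3 * δ ≤ κ → ∀ ω : Literature.Probability.Percolation.BondConfig (Literature.Probability.LatticeModels.Site 2), ω ⊆ Literature.Probability.LatticeModels.triGraph.edgeSet →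
        ω ∈ Literature.Probability.Percolation.openCrossing {x : Literature.Probability.LatticeModels.Site 2 | Metric.closedBall ((δ : ℂ) * ((Real.sqrt 3 : ℂ) * (Literature.Probability.LatticeModels.triEmbed x - (1 + Literature.Probability.LatticeModels.triZeta) / 3))) ρ ⊆ Summit.CriticalPhenomena.CardyFormulaZ2.Theorems.CornerLineDescent.SymmetricSeed.Freeze.enlarge R κ} {x : Literature.Probability.LatticeModels.Site 2 | Metric.closedBall ((δ : ℂ) * ((Real.sqrt 3 : ℂ) * (Literature.Probability.LatticeModels.triEmbed x - (1 + Literature.Probability.LatticeModels.triZeta) / 3))) ρ ⊆ Summit.CriticalPhenomena.CardyFormulaZ2.Theorems.CornerLineDescent.SymmetricSeed.Freeze.sideCollar R 0 κ \ R.carrier} {x : Literature.Probability.LatticeModels.Site 2 | Metric.closedBall ((δ : ℂ) * ((Real.sqrt 3 : ℂ) * (Literature.Probability.LatticeModels.triEmbed x - (1 + Literature.Probability.LatticeModels.triZeta) / 3))) ρ ⊆ Summit.CriticalPhenomena.CardyFormulaZ2.Theorems.CornerLineDescent.SymmetricSeed.Freeze.sideCollar R 2 κ \ R.carrier} →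
          ω ∈ Literature.Probability.Percolation.embDomainCrossing (fun x : Literature.Probability.LatticeModels.Site 2 ↦ (Real.sqrt 3 : ℂ) * (Literature.Probability.LatticeModels.triEmbed x - (1 + Literature.Probability.LatticeModels.triZeta) / 3)) R.carrier δ (R.arc 0) (R.arc 2)

/-- Signature of `stub_boundaryInsensitivitySq` (unchanged from the birth registration; LANDED). -/
def Sig.stub_boundaryInsensitivitySq : Prop :=
    ∀ R : Literature.Probability.RandomPlanarGeometry.ConformalRectangle, ∀ ε : ℝ, 0 < ε → ∃ ρ₀ : ℝ, 0 < ρ₀ ∧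
      ∀ᶠ δ : ℝ in 𝓝[>] (0 : ℝ), ∀ ρ ∈ Set.Ioc (0 : ℝ) ρ₀,
        (Literature.Probability.Percolation.bondPercolation (Literature.Probability.LatticeModels.zdGraph 2) Literature.Probability.Percolation.half).real (Literature.Probability.Percolation.openCrossing {y : Literature.Probability.LatticeModels.Site 2 | (δ : ℂ) * Literature.Probability.LatticeModels.squareLatticeEmbedding.z y ∈ Metric.thickening ρ R.carrier} {u : Literature.Probability.LatticeModels.Site 2 | Metric.infDist ((δ : ℂ) * Literature.Probability.LatticeModels.squareLatticeEmbedding.z u) (R.arc 0) ≤ 2 * δ + ρ} {v : Literature.Probability.LatticeModels.Site 2 | Metric.infDist ((δ : ℂ) * Literature.Probability.LatticeModels.squareLatticeEmbedding.z v) (R.arc 2) ≤ 2 * δ + ρ})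
          ≤ (Literature.Probability.Percolation.bondPercolation (Literature.Probability.LatticeModels.zdGraph 2) Literature.Probability.Percolation.half).real (Literature.Probability.Percolation.embDomainCrossing Literature.Probability.LatticeModels.squareLatticeEmbedding.z R.carrier δ (R.arc 0) (R.arc 2)) + ε

/-! ### The stubs -/

/-- **STUB 1 — THE HEART: shadow transport between canonical bond-`𝕋` and bond-`ℤ²` at `1/2`**
(`Sig.stub_lowerTransport ∧ Sig.stub_upperTransport`).
(`ℤ² → 𝕋`, thinned collar-to-collar events) For every conformal rectangle `R` there is a mesh
correspondence `m : ℝ → ℝ`, `m → 0⁺` along `δ → 0⁺` (both drawings are isoradial of circumradius `1`,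
so `m = id` is expected), such that for every collar scale `κ > 0`, thinning radius `ρ > 0` and
`ε > 0`, eventually as `δ → 0⁺`: `P_ℤ(Freeze.lowerCrossing R κ ρ δ) ≤ P_𝕋(lower_𝕋(R; κ, ρ/2; m δ)) + ε`.
(`𝕋 → ℤ²`, crude to relaxed) For every `R` there is `m → 0⁺` such that for every `ρ > 0`, `ε > 0`,
eventually: `P_𝕋(crude_𝕋(R; m δ)) ≤ P_ℤ(relaxed_ℤ(R; ρ; δ)) + ε`.
Why plausibly true: a coupling of bond-`ℤ²` at `1/2` (mesh `δ`) with canonical bond-`𝕋` (mesh `m δ`)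
under which, with probability `≥ 1 − ε`, the macroscopic primal and dual interfaces of the two
configurations in a bounded window agree within `r(δ) → 0` (the bi-periodic universality coupling:
Grimmett–Manolescu's star–triangle track exchanges made `o(1)`-sharp — DKKMO2020 Thm 1.2/1.7 and
Manolescu2025 Thm 5.3 inside the rectangular family `𝕃(α)`, tree renderings
`dkkmo_universality_coupling`, `DKKMO2020_thm21_quadCrossingProb`; announced for all bi-periodic
isoradial graphs as [HM24], Manolescu2025 Rem. 5.6) gives both conjuncts, because both compare
crossing-type events WITH A MARGIN (`ρ` versus `ρ/2`; open `Ω` versus its `ρ`-thickening): a failure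
would put an open crossing of one model across a dual-closed cut of the other at distance `≫ r(δ)`.
Why it might fail: the `o(1)` drift control is in print only for `𝕃(α)` (two track families); `𝕋`
needs a third track family and [HM24] is unreleased; no tree fact concerns a `(𝕋, ℤ²)` comparison at
all (not even RSW for bond-`𝕋`, item 7023). Size XL — crux-sized: it is the universality content of
the crux, freed of `Φ`, limits and boundary bookkeeping. Leans on: nothing proved; vocabulary
`Freeze.lowerCrossing/enlarge/sideCollar`, `embDomainCrossing`, `openCrossing`; sources
GrimmettManolescuAOP2013, GrimmettManolescu2014Isoradial, DKKMO2020Rotational,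
Manolescu2025ExploringFK, HansenManolescu2024LargeScale. -/
theorem stub_shadowTransport : Sig.stub_shadowTransport := by
  sorry

/-- **STUB 2 — run extraction on `𝕋` (CLOSED, wave 2: landed as
`Theorems.TriangularToSquareTransport.stub_lowerCrossingTri_subset_crude`, p151080).** For `0 < δ`, `0 ≤ ρ`,
`√3 δ ≤ κ` and a configuration `ω` on the edges of `triGraph`, a thinned collar-to-collar open crossing
`lower_𝕋(R; κ, ρ; δ)` is a crude crossing `embDomainCrossing z_𝕋 Ω δ (arc 0) (arc 2)`: the path runs
inside `Freeze.enlarge R κ` from `collar₀ ∖ Ω` to `collar₂ ∖ Ω` with steps of length `√3 δ ≤ κ`, so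
`Freeze.exists_crossing_run` extracts a run inside `Ω` entered through `arc 0` and left through
`arc 2`, whose ends are within `√3 δ ≤ 2δ` of the arcs (mirror of
`Freeze.lowerCrossing_subset_embDomainCrossing`; the `𝕋` edge length is
`LatticeModels.norm_triEmbed_eq_one_of_adj` times `√3 δ`). -/
theorem stub_lowerCrossingTri_subset_crude : Sig.stub_lowerCrossingTri_subset_crude :=
  Summit.CriticalPhenomena.CardyFormulaZ2.Theorems.TriangularToSquareTransport.lowerCrossingTri_subset_crude

/-- **STUB 3 — boundary insensitivity of the crude event on bond-`ℤ²` (CLOSED, wave 1).** Landed as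
`Theorems.TriangularToSquareTransport.stub_boundaryInsensitivitySq` (p148884); here by `exact` on its
expanded form `boundaryInsensitivitySq`. -/
theorem stub_boundaryInsensitivitySq : Sig.stub_boundaryInsensitivitySq :=
  Summit.CriticalPhenomena.CardyFormulaZ2.Theorems.TriangularToSquareTransport.boundaryInsensitivitySq

/-! ### The composition (sorry-free): the four stub statements give the crux BY NAME -/

/-- **The line closes the crux (directed form).** Hypotheses: the two directed transports, the run
extraction and the `ℤ²` boundary insensitivity; conclusion: literally the route decl
`CardyBondTriangular.TriangularToSquareTransport`. See the module docstring for the `ε/4` chains. -/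
theorem TriangularToSquareTransport_of_directed :
    Sig.stub_lowerTransport → Sig.stub_upperTransport → Sig.stub_lowerCrossingTri_subset_crude →
      Sig.stub_boundaryInsensitivitySq →
      Summit.CriticalPhenomena.CardyFormulaZ2.Theses.CardyBondTriangular.TriangularToSquareTransport := by
  dsimp only [Sig.stub_lowerTransport, Sig.stub_upperTransport, Sig.stub_lowerCrossingTri_subset_crude,
    Sig.stub_boundaryInsensitivitySq]
  intro hL hU hX hB Φ hT R φ x hux
  have hlim : Tendsto (fun δ ↦ (Literature.Probability.Percolation.bondPercolation Literature.Probability.LatticeModels.triGraph (Literature.Probability.LatticeModels.criticalWeightI (Real.pi / 6))).real (Literature.Probability.Percolation.embDomainCrossing (fun x : Literature.Probability.LatticeModels.Site 2 ↦ (Real.sqrt 3 : ℂ) * (Literature.Probability.LatticeModels.triEmbed x - (1 + Literature.Probability.LatticeModels.triZeta) / 3)) R.carrier δ (R.arc 0) (R.arc 2))) (𝓝[>] (0 : ℝ)) (𝓝 (Φ (Literature.Probability.RandomPlanarGeometry.crossRatio x))) :=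
    hT R φ x hux
  obtain ⟨m, hm, hLm⟩ := hL R
  obtain ⟨m', hm', hUm⟩ := hU R
  rw [Metric.tendsto_nhds]
  intro ε hε
  have hε4 : 0 < ε / 4 := by positivity
  -- mesh-uniform continuity of crude bond-ℤ² crossings (tree theorem) at ε/4
  obtain ⟨κ, hκ, ρ, hρ, hcont⟩ :=
    Summit.CriticalPhenomena.CardyFormulaZ2.Theorems.CornerLineDescent.SymmetricSeed.stub_CrudeCrossingContinuity_of_SS
      Literature.Probability.Percolation.QuadCrossing.SchrammSmirnov2011_lemma_5_1_holds R (ε / 4) hε4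
  -- boundary insensitivity on ℤ² at ε/4
  obtain ⟨ρ₀, hρ₀, hbZ⟩ := hB R (ε / 4) hε4
  -- the two transports at ε/4
  have h1 := hLm κ hκ ρ hρ (ε / 4) hε4
  have h2 := hUm ρ₀ hρ₀ (ε / 4) hε4
  -- the 𝕋-limit along the two mesh correspondences
  have h3 := Metric.tendsto_nhds.1 (hlim.comp hm) (ε / 4) hε4
  have h4 := Metric.tendsto_nhds.1 (hlim.comp hm') (ε / 4) hε4
  -- smallness of δ and of m δ
  have h5 : ∀ᶠ δ in 𝓝[>] (0 : ℝ), δ ∈ Set.Ioo (0 : ℝ) (ρ / 2) := Ioo_mem_nhdsGT (by positivity)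
  have h6 : ∀ᶠ δ in 𝓝[>] (0 : ℝ), m δ ∈ Set.Ioo (0 : ℝ) (κ / 2) :=
    hm.eventually (Ioo_mem_nhdsGT (by positivity))
  filter_upwards [h1, h2, h3, h4, h5, h6, hcont, hbZ] with δ h1δ h2δ h3δ h4δ h5δ h6δ hcδ hbδ
  have hδ : 0 < δ := h5δ.1
  have h2δρ : 2 * δ ≤ ρ := by linarith [h5δ.2]
  have hmδ : 0 < m δ := h6δ.1
  have hsq3 : Real.sqrt 3 * m δ ≤ κ := by
    have h3le : Real.sqrt 3 ≤ 2 := (Real.sqrt_le_left zero_le_two).2 (by norm_num)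
    nlinarith [h6δ.2]
  -- UPPER chain, step 1: crude_ℤ ⊆ upper_ρ
  have hA : (Literature.Probability.Percolation.bondPercolation (Literature.Probability.LatticeModels.zdGraph 2) Literature.Probability.Percolation.half).real (Literature.Probability.Percolation.embDomainCrossing Literature.Probability.LatticeModels.squareLatticeEmbedding.z R.carrier δ (R.arc 0) (R.arc 2)) ≤
      (Literature.Probability.Percolation.bondPercolation (Literature.Probability.LatticeModels.zdGraph 2) Literature.Probability.Percolation.half).real (Summit.CriticalPhenomena.CardyFormulaZ2.Theorems.CornerLineDescent.SymmetricSeed.Freeze.upperCrossing R ρ δ) :=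
    measureReal_mono (Summit.CriticalPhenomena.CardyFormulaZ2.Theorems.CornerLineDescent.SymmetricSeed.Freeze.embDomainCrossing_subset_upperCrossing R hδ.le h2δρ)
  -- UPPER chain, step 3: lower_𝕋 ⊆ crude_𝕋 a.s.
  have hae : ∀ᵐ ω ∂ (Literature.Probability.Percolation.bondPercolation Literature.Probability.LatticeModels.triGraph (Literature.Probability.LatticeModels.criticalWeightI (Real.pi / 6))), ω ⊆ Literature.Probability.LatticeModels.triGraph.edgeSet :=
    Literature.Probability.Percolation.ae_subset_edgeSet _ _
  have hC : (Literature.Probability.Percolation.bondPercolation Literature.Probability.LatticeModels.triGraph (Literature.Probability.LatticeModels.criticalWeightI (Real.pi / 6))).real (Literature.Probability.Percolation.openCrossing {x : Literature.Probability.LatticeModels.Site 2 | Metric.closedBall (((m δ : ℝ) : ℂ) * ((Real.sqrt 3 : ℂ) * (Literature.Probability.LatticeModels.triEmbed x - (1 + Literature.Probability.LatticeModels.triZeta) / 3))) (ρ / 2) ⊆ Summit.CriticalPhenomena.CardyFormulaZ2.Theorems.CornerLineDescent.SymmetricSeed.Freeze.enlarge R κ} {x : Literature.Probability.LatticeModels.Site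 2 | Metric.closedBall (((m δ : ℝ) : ℂ) * ((Real.sqrt 3 : ℂ) * (Literature.Probability.LatticeModels.triEmbed x - (1 + Literature.Probability.LatticeModels.triZeta) / 3))) (ρ / 2) ⊆ Summit.CriticalPhenomena.CardyFormulaZ2.Theorems.CornerLineDescent.SymmetricSeed.Freeze.sideCollar R 0 κ \ R.carrier} {x : Literature.Probability.LatticeModels.Site 2 | Metric.closedBall (((m δ : ℝ) : ℂ) * ((Real.sqrt 3 : ℂ) * (Literature.Probability.LatticeModels.triEmbed x - (1 + Literature.Probability.LatticeModels.triZeta) / 3))) (ρ / 2) ⊆ Summit.CriticalPhenomena.CardyFormulaZ2.Theorems.CornerLineDescent.SymmetricSeed.Freeze.sideCollar R 2 κ \ R.carrier}) ≤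
      (Literature.Probability.Percolation.bondPercolation Literature.Probability.LatticeModels.triGraph (Literature.Probability.LatticeModels.criticalWeightI (Real.pi / 6))).real (Literature.Probability.Percolation.embDomainCrossing (fun x : Literature.Probability.LatticeModels.Site 2 ↦ (Real.sqrt 3 : ℂ) * (Literature.Probability.LatticeModels.triEmbed x - (1 + Literature.Probability.LatticeModels.triZeta) / 3)) R.carrier (m δ) (R.arc 0) (R.arc 2)) := by
    refine ENNReal.toReal_mono (measure_ne_top _ _) (measure_mono_ae ?_)
    filter_upwards [hae] with ω hω hlow
    exact hX R κ (ρ / 2) (m δ) hmδ (by positivity) hsq3 ω hω hlow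
  -- LOWER chain, step 2: relaxed_ρ₀ ≤ crude + ε/4
  have hD := hbδ ρ₀ ⟨hρ₀, le_rfl⟩
  simp only [Function.comp_apply] at h3δ h4δ
  rw [Real.dist_eq, abs_sub_lt_iff] at h3δ h4δ ⊢
  obtain ⟨h3a, h3b⟩ := h3δ
  obtain ⟨h4a, h4b⟩ := h4δ
  constructor <;> linarith

/-- **The line closes the crux.** Hypotheses: the three registered stub statements (heart, run
extraction, `ℤ²` boundary insensitivity); conclusion: literally the route decl. -/
theorem TriangularToSquareTransport_of :
    Sig.stub_shadowTransport → Sig.stub_lowerCrossingTri_subset_crude → Sig.stub_boundaryInsensitivitySq →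
      Summit.CriticalPhenomena.CardyFormulaZ2.Theses.CardyBondTriangular.TriangularToSquareTransport :=
  fun hS hX hB ↦ TriangularToSquareTransport_of_directed hS.1 hS.2 hX hB

/-- The crux from the three registered stubs, used BY NAME (only unproved dependency:
`stub_shadowTransport`). -/
theorem TriangularToSquareTransport_of_stubs :
    Summit.CriticalPhenomena.CardyFormulaZ2.Theses.CardyBondTriangular.TriangularToSquareTransport :=
  TriangularToSquareTransport_of stub_shadowTransport stub_lowerCrossingTri_subset_crude
    stub_boundaryInsensitivitySq

end Summit.CriticalPhenomena.CardyFormulaZ2.Cruxes.TriangularToSquareTransport.Birth
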